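import Literature.Topology.CoveringSpaces.CoveringGaloisCorrespondenceEquivalence
import Literature.GroupTheory.FiniteActionProfiniteCompletion
import Literature.AnabelianGeometry.AbsoluteAnabelian.SlimIdRigid
import Literature.AlgebraicTopology.FundamentalGroup.FreeGroupPuncturedPlane
import Literature.AlgebraicTopology.Homotopy.ManifoldStronglyLocallyContractible
import Literature.GroupTheory.FreeGroupProfiniteCompletionSlim
import Mathlib.Analysis.Normed.Module.Connected
import Mathlib.LinearAlgebra.Complex.FiniteDimensional
import HarnessLib

/-!
# Id-rigidity of categories of covering spaces: `π̂₁(X)` slim ⇒ `Cov^fin(X)` id-rigid,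
# `Z(π₁(X)) = 1 ⇔ Cov(X)` id-rigid; the thrice-punctured sphere (every `ℂ ∖ F`, `2 ≤ |F| < ∞`)
# unconditionally

Topic `Literature/Topology/CoveringSpaces` — CAPSTONE of the topological Galois correspondence for
covering spaces (abc-iut cell, campaign-L R1, GAP row G-L4t14-R1; the mechanism of [AbsTopIII]
Lemma 4.3 → Proposition 4.2 (i) at the TOPOLOGICAL level, t14's MEMO-geometric-EA-residual §2
items 1–3):

`Cov^fin(X) ≌ Action FintypeCat π₁(X, x₀)` (`CovFin.galoisCorrespondence`, Hatcher Thm. 1.38)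
`≌ ContAction FintypeCat π̂₁ = B(π̂₁)` (`FiniteActionCompletion.equivalence`, finite `π₁`-sets are
continuous finite `π̂₁`-sets) and `B(Π)` is id-rigid for every SLIM profinite `Π` (the tree's
`isIdRigid_bCat_of_isSlimGroup`, [AbsTopIII] §0 p. 27 / [SemiAnbd] §0); id-rigidity transports along
equivalences (`isIdRigid_of_equivalence`).  Hence:

* `CovFin.isIdRigid_of_isIdRigid_bCat`, **`CovFin.isIdRigid_of_isSlimGroup`** — for `X` path connected
  and strongly locally contractible with `π̂₁(X, x₀)` slim, every automorphism of the identity functor of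
  `Cov^fin(X)` is the identity («a compatible family of deck-commuting automorphisms of all finite
  covers of `X` is trivial»);
* slimness input: a group isomorphic to a free group of rank `≥ 2` has SLIM profinite completion
  — the tree's `Literature.GroupTheory.isSlimGroup_profiniteCompletion_of_mulEquiv_freeGroup`
  (FreeGroupProfiniteCompletionSlim.lean, [AbsAnab] Lemma 1.3.1), consumed by name;
* **`CovFin.isIdRigid_compl_finite`** — for `F ⊆ ℂ` finite with `2 ≤ |F|` (e.g. the thrice-punctured
  sphere `ℂ ∖ {0, 1}`), the category of finite covering spaces of `ℂ ∖ F` is ID-RIGID, unconditionally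
  (`π₁(ℂ ∖ F) ≅ F_{|F|}` by the tree's `FreeGroupPuncturedPlane`).

* (ALL covers, `Z(π₁) = 1 ⇔ Cov(X)` id-rigid: the sequel `CoveringIdRigidCenter.lean`.)

Everything is proved; one definition (`CovFin.equivBCat`), no instances, no named facts.

## References

* S. Mochizuki, *Topics in Absolute Anabelian Geometry III*, §0 p. 27 (slim ⇒ id-rigid), Lemma 4.3,
  Proposition 4.2 (i) p. 106. [MochizukiAbsTopIII2015]
* A. Hatcher, *Algebraic Topology*, CUP 2002, §1.3 Thm. 1.38. [HatcherAT2002]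
* S. Mochizuki, *The absolute anabelian geometry of hyperbolic curves*, Lemma 1.3.1 (slimness of
  free profinite groups). [MochizukiAbsAnab2004]
-/

noncomputable section

open CategoryTheory Set
open Literature.AlgebraicGeometry.Frobenioids (BCat IsSlimGroup)
open Literature.AnabelianGeometry.AbsoluteAnabelian (IsIdRigid isIdRigid_of_equivalence
  isIdRigid_bCat_of_isSlimGroup)
open Literature.IUT.HodgeTheaters (profiniteCompletion toCompletion)
open Literature.GroupTheory (FiniteActionCompletion.equivalence)

universe u

namespace Literature.Topology.CoveringSpaces

/-! ### §1 `π̂₁` slim ⇒ `Cov^fin(X)` id-rigid -/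

namespace CovFin

variable {X : Type u} [TopologicalSpace X] [PathConnectedSpace X] [StronglyLocallyContractibleSpace X]
  (x₀ : X)

/-- **`Cov^fin(X) ≌ B(π̂₁(X, x₀))`**: the finite Galois correspondence composed with «finite `π₁`-sets =
continuous finite `π̂₁`-sets». [cite: MochizukiAbsTopIII2015, Definition 4.1 (iii) p.103 (the
Galois category `B(Π_X)` of finite étale coverings)] -/
def equivBCat : CovFin X ≌ BCat (profiniteCompletion (FundamentalGroup X x₀)) :=
  (CovFin.galoisCorrespondence x₀).trans (FiniteActionCompletion.equivalence (FundamentalGroup X x₀))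

/-- Id-rigidity of `B(π̂₁)` transports to `Cov^fin(X)`. [cite: MochizukiAbsTopIII2015, Section 0 p.27] -/
theorem isIdRigid_of_isIdRigid_bCat
    (h : IsIdRigid (BCat (profiniteCompletion (FundamentalGroup X x₀)))) : IsIdRigid (CovFin X) :=
  isIdRigid_of_equivalence (equivBCat x₀) h

end CovFin

namespace CovFin

variable {X : Type} [TopologicalSpace X] [PathConnectedSpace X] [StronglyLocallyContractibleSpace X]
  (x₀ : X)

/-- **`π̂₁(X, x₀)` SLIM ⇒ THE CATEGORY OF FINITE COVERING SPACES OF `X` IS ID-RIGID** — the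
topological form of [AbsTopIII] Lemma 4.3 ⇒ Proposition 4.2 (i): every automorphism of the
identity functor of `Cov^fin(X)` (a family of self-homeomorphisms of all finite covers of `X`,
compatible with ALL maps of covers) is trivial.  (`X` path connected, strongly locally contractible;
universe `0`, where the tree's `isIdRigid_bCat_of_isSlimGroup` lives.)
[cite: MochizukiAbsTopIII2015, Proposition 4.2 (i) p.106] -/
theorem isIdRigid_of_isSlimGroup
    (h : IsSlimGroup (profiniteCompletion (FundamentalGroup X x₀))) : IsIdRigid (CovFin X) :=
  isIdRigid_of_isIdRigid_bCat x₀ (isIdRigid_bCat_of_isSlimGroup _ h)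

end CovFin

/-! ### §2 The thrice-punctured sphere: `Cov^fin(ℂ ∖ F)` is id-rigid for `2 ≤ |F| < ∞` -/

/-- `ℂ ∖ F` is path connected for `F` finite (complement of a countable set in a real vector space
of dimension `> 1`). [cite: HatcherAT2002, §1.2 Example 1.21] -/
theorem pathConnectedSpace_compl_finite {F : Set ℂ} (hF : F.Finite) : PathConnectedSpace ↥(Fᶜ) :=
  isPathConnected_iff_pathConnectedSpace.1
    (hF.countable.isPathConnected_compl_of_one_lt_rank (by rw [Complex.rank_real_complex]; norm_num))

/-- `ℂ ∖ F` is strongly locally contractible (an open subset of the plane).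
[cite: HatcherAT2002, Cor. A.9 (proof)] -/
theorem stronglyLocallyContractibleSpace_compl_finite {F : Set ℂ} (hF : F.Finite) :
    StronglyLocallyContractibleSpace ↥(Fᶜ) := by
  haveI := Literature.AlgebraicTopology.Homotopy.stronglyLocallyContractibleSpace_of_normedSpace ℂ
  exact hF.isClosed.isOpen_compl.stronglyLocallyContractibleSpace

/-- **`π̂₁(ℂ ∖ F)` is slim** for `F` finite with `2 ≤ |F|`: `π₁(ℂ ∖ F) ≅ F_{|F|}` (the tree's
`nonempty_mulEquiv_freeGroup_compl_finite`) is free of rank `≥ 2`.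
[cite: MochizukiAbsAnab2004, Lemma 1.3.1 p.15] -/
theorem isSlimGroup_profiniteCompletion_fundamentalGroup_compl_finite {F : Set ℂ} (hF : F.Finite)
    (h2 : 2 ≤ F.ncard) (x : ↥(Fᶜ)) : IsSlimGroup (profiniteCompletion (FundamentalGroup ↥(Fᶜ) x)) := by
  obtain ⟨e⟩ := Literature.AlgebraicTopology.FundamentalGroup.nonempty_mulEquiv_freeGroup_compl_finite
    hF x
  exact Literature.GroupTheory.isSlimGroup_profiniteCompletion_of_mulEquiv_freeGroup e h2

/-- **THE CATEGORY OF FINITE COVERING SPACES OF `ℂ ∖ F` IS ID-RIGID** for every finite `F ⊆ ℂ` with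
at least two points — in particular for the thrice-punctured sphere `ℙ¹ ∖ {0, 1, ∞} = ℂ ∖ {0, 1}`:
the topological core of [AbsTopIII] Prop. 4.2 (i) for hyperbolic curves of genus `0`,
UNCONDITIONALLY (no named fact). [cite: MochizukiAbsTopIII2015, Proposition 4.2 (i) p.106] -/
theorem CovFin.isIdRigid_compl_finite {F : Set ℂ} (hF : F.Finite) (h2 : 2 ≤ F.ncard) :
    IsIdRigid (CovFin ↥(Fᶜ)) := by
  haveI := pathConnectedSpace_compl_finite hF
  haveI := stronglyLocallyContractibleSpace_compl_finite hF
  have x : ↥(Fᶜ) := Classical.arbitrary _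
  exact CovFin.isIdRigid_of_isSlimGroup x
    (isSlimGroup_profiniteCompletion_fundamentalGroup_compl_finite hF h2 x)

/-- The thrice-punctured sphere: `Cov^fin(ℂ ∖ {0, 1})` is id-rigid.
[cite: MochizukiAbsTopIII2015, Proposition 4.2 (i) p.106] -/
theorem CovFin.isIdRigid_thricePuncturedSphere : IsIdRigid (CovFin ↥(({0, 1} : Set ℂ)ᶜ)) :=
  CovFin.isIdRigid_compl_finite (Set.toFinite _) (by
    rw [Set.ncard_pair (by norm_num)])

end Literature.Topology.CoveringSpaces

end
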